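import Literature.NumberTheory.Automorphic.ResGLnCuspidalCohomologyApexKuga
import Literature.NumberTheory.Automorphic.ResGLnCuspidalCohomologyApexScalars
import Literature.NumberTheory.Automorphic.ResGLnCasimirScalarOfArchParameter
import Literature.NumberTheory.Automorphic.GLnCoeffModuleCasimirValue
import HarnessLib

/-!
# Clozel's Lemme 3.14/3.15 for `Res_{K/ℚ} GLₙ`: reduction of the apex fact to a non-zero level-fixed
# basic cochain

Topic `NumberTheory/Automorphic`; namespace `Literature.NumberTheory.Automorphic.ConeDictionary`
(vocabulary of `ResGLnCuspidalCohomologyApex{Basic,Kuga,Scalars}`).  One theorem; no named fact,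
no `sorry`.

`ResGLnCuspidalCohomologyApexKuga.Clozel1990_exists_basic_levelFixed_cocycle_of_nonzero_basic_cochain`
reduces the apex fact `Clozel1990_exists_basic_levelFixed_cocycle` (for a clean cohomological cuspidal
`π` of `GL_n(𝔸_K)` with a `K(𝔫)`-fixed form: a basic level-`𝔫`-fixed cocycle of
`C^•(𝔤, K_∞; W ⊗ (E_λ ⊗ ε_S))` which is not a coboundary) to three inputs: (i) the trace-form Casimir
operators of `W` and of `E_λ` act by the SAME scalar, (ii) `Z = 1 ∈ 𝔤` kills `W ⊗ E_λ`, (iii) a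
NON-ZERO level-fixed basic cochain exists.  Inputs (i) and (ii) are consequences of the infinity-type
hypothesis and are now theorems of the tree:

* (i)  `ResGLnCasimirScalarOfArchParameter.op_lieRepW_apply_of_cohomological` — on `W` the Casimir is
  `∑_σ (∑_i (λ_{σ,i} + ρ_i)² - ∑_i ρ_i²)` (Harish-Chandra parameter `{λ^∨_{σ,i} + ρ_i}` of `π_∞`), and
  `GLnCoeffModuleCasimirValue.op_σ𝔤S_apply_eq_smul` — on `E_λ` it is the same number
  (Goodman–Wallach, Lemma 3.3.8 on each `V_{λ_σ}(ℂ)`);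
* (ii) `ResGLnCuspidalCohomologyApexScalars.lie_one_carrier_eq_zero` — `Z` acts on `W` by `-∑ λ` and
  on `E_λ` by `∑ λ`.

Hence **`Clozel1990_exists_basic_levelFixed_cocycle_of_nonzero_cochain`**: the apex fact follows from
(iii) alone — for every `n ≥ 2`, `𝔫 ≠ 0`, dominant `λ` and clean cohomological cuspidal `π` with a
non-zero `K(𝔫)`-fixed form there are a set `S` of real places, a degree `q + 1` and a non-zero
level-`𝔫`-fixed cochain `η ∈ C^{q+1}(𝔤, K_∞; W ⊗ (E_λ ⊗ ε_S))` with `i_Z η = 0`.  This residual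
statement is the `K_∞`-type content of Clozel's Lemme 3.14 (`Hom_{K_∞}(Λ^{q+1}(𝔤/𝔨 ⊕ ℝ Z)^*…,
π_∞^{K…} ⊗ E_λ ⊗ ε_S) ≠ 0`, Vogan–Zuckerman's `K`-type criterion), cf. the module docstring of
`ResGLnCuspidalCohomologyApexKuga`.

[cite: Clozel1990, Lemme 3.14 (p. 114), Lemme 3.15 (p. 121)] [cite: BorelWallach2000, II Prop. 3.1, I §5]

## References

* L. Clozel, *Motifs et formes automorphes: applications du principe de fonctorialité*, in:
  Automorphic forms, Shimura varieties, and L-functions I (Ann Arbor 1988), Perspect. Math. 10,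
  Academic Press 1990: Lemme 3.14 (p. 114, proof pp. 114–120), Lemme 3.15 (p. 121). [Clozel1990]
* A. Borel, N. Wallach, *Continuous cohomology, discrete subgroups, and representations of reductive
  groups*, 2nd ed., AMS 2000: I §5, II §2.5, II Prop. 3.1 (held). [BorelWallach2000]
* R. Goodman, N. R. Wallach, *Symmetry, Representations, and Invariants*, GTM 255 (2009), Lemma 3.3.8
  (held). [GoodmanWallachGTM255]
-/

noncomputable section

open scoped Classical TensorProduct Matrix
open NumberField IsDedekindDomain NumberField.InfinitePlace NumberField.mixedEmbedding

namespace Literature.NumberTheory.Automorphic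

namespace ConeDictionary

open ResGLnCohomology BigHeckeGLn RealMatrixGroup Literature.Algebra.Lie.ChevalleyEilenberg
  Literature.NumberTheory.DiophantineGeometry Literature.Barriers.Langlands

/-- **Clozel's Lemme 3.14/3.15 reduced to the existence of a non-zero level-fixed basic cochain.**
The apex fact `Clozel1990_exists_basic_levelFixed_cocycle` holds as soon as, for every `n ≥ 2`,
`𝔫 ≠ 0`, dominant `λ` and clean cohomological cuspidal `π` of `GL_n(𝔸_K)` with a non-zero
`K(𝔫)`-fixed form, some `C^{q+1}(𝔤, K_∞; W ⊗ (E_λ ⊗ ε_S))` contains a non-zero level-`𝔫`-fixed cochain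
`η` with `i_Z η = 0`: by Kuga's lemma (`…_of_nonzero_basic_cochain`) with the Casimir scalars of `W`
(`op_lieRepW_apply_of_cohomological`) and of `E_λ` (`op_σ𝔤S_apply_eq_smul`), which agree, and the
vanishing of `Z` on `W ⊗ E_λ` (`lie_one_carrier_eq_zero`), such an `η` is a cocycle and not a
coboundary. [cite: Clozel1990, Lemme 3.14 (p. 114), Lemme 3.15 (p. 121)]
[cite: BorelWallach2000, II Prop. 3.1, I §5] -/
theorem Clozel1990_exists_basic_levelFixed_cocycle_of_nonzero_cochain
    (H : ∀ (n : ℕ) (K : Type) [Field K] [NumberField K] (hcpt : isCompact_glFiniteIntegralLevel n K)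
      (𝔫 : Ideal (𝓞 K)) (lam : (K →+* ℂ) → Fin n → ℤ), 2 ≤ n → 𝔫 ≠ 0 →
      (∀ τ, Weight.IsDominant (lam τ)) →
      ∀ π : CuspidalAutomorphicRepData n K hcpt, π.1.W' = ⊥ →
        (∃ μ : ℂ, ∀ c ∈ π.1.W, lieDeriv (AutomorphyDatum.gl n K hcpt).ofArch
          (⟨1, trivial⟩ : (AutomorphyDatum.gl n K hcpt).arch.lie) c = μ • c) →
        (∃ T : InfinityType K n, π.1.HasInfinityType T ∧
          ∀ τ : K →+* ℂ, (T τ).map ArchWeight.a =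
            (cohomologicalInfinityType n K (Weight.dual (lam τ)) τ).map ArchWeight.a) →
        (∃ φ ∈ π.1.W, φ ≠ 0 ∧
          ∀ u ∈ principalCongruenceLevel n K 𝔫, rightTranslation (AdelicGroupData.gl n K) u φ = φ) →
        ∃ (S : Finset {w : InfinitePlace K // w.IsReal}) (q : ℕ) (η : Cochain π.1 lam (q + 1)),
          η ∈ (gkComplexLS π.1 S lam).carrier (q + 1) ∧ IsLevelFixed π.1 lam 𝔫 η ∧
            Literature.Algebra.Lie.ChevalleyEilenberg.ins q
                (⟨1, trivial⟩ : (AutomorphyDatum.gl n K hcpt).arch.lie) η = 0 ∧ η ≠ 0) :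
    Clozel1990_exists_basic_levelFixed_cocycle := by
  refine Clozel1990_exists_basic_levelFixed_cocycle_of_nonzero_basic_cochain ?_
  intro n K _ _ hcpt 𝔫 lam hn h𝔫 hdom π hW' hμ hT hφ
  have hη := H n K hcpt 𝔫 lam hn h𝔫 hdom π hW' hμ hT hφ
  obtain ⟨μ, hμ'⟩ := hμ
  obtain ⟨T, hT1, hTa⟩ := hT
  obtain ⟨φ, hφW, hφ0, -⟩ := hφ
  have hc : ∀ v : π.1.W, GKCasimir.op (AutomorphyDatum.gl n K hcpt).arch π.1.lieRepW (bD n K hcpt) (dD n K hcpt) v =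
      (∑ σ : K →+* ℂ, (∑ i : Fin n, ((lam σ i : ℂ) + rhoGL n i) ^ 2 - ∑ i : Fin n, rhoGL n i ^ 2)) • v :=
    fun v => op_lieRepW_apply_of_cohomological π.1 lam hW' hT1 hTa v
  have hc' : ∀ e : ResGLnCohomology.CoeffModule ℂ n K lam,
      GKCasimir.op (AutomorphyDatum.gl n K hcpt).arch (σ𝔤S hcpt lam) (bD n K hcpt) (dD n K hcpt) e =
        (∑ σ : K →+* ℂ, (∑ i : Fin n, ((lam σ i : ℂ) + rhoGL n i) ^ 2 - ∑ i : Fin n, rhoGL n i ^ 2)) • e :=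
    fun e => op_σ𝔤S_apply_eq_smul n K hcpt lam hdom e
  have hZ : ∀ t : Carrier π.1 lam, ⁅(⟨1, trivial⟩ : (AutomorphyDatum.gl n K hcpt).arch.lie), t⁆ = 0 :=
    fun t => lie_one_carrier_eq_zero π.1 lam hdom hW' hμ' hT1 hTa hφW hφ0 t
  exact ⟨⟨_, hc, hc'⟩, hZ, hη⟩

end ConeDictionary

end Literature.NumberTheory.Automorphic

end
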